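import Summits.Schanuel.Schanuel.Theorems.RootDecomp1KDegreeLadder02

/-!
# RootDecomp1KDegreeLadder — lens 1, generation 45 «DEGREE LADDER AT FIXED SKEL-QUALITY (DL) + THIN-FIBRE RESIDUAL» (lane K-R30 (b); CLAIM L2155, ACK/CHECKLIST K-g45 L2159, NODE L2213 / REQUEST L2214, writer re-checks L2219/L2221/L2230, critic VERDICT L2216: CLEARED — THEOREM ×1 for DL `degreeLadder`; EDITION 2/3 docstring-only accepted L2224 / files of record L2228 (K ed. 3 f2af863f…); RULE K-R31; lens-1 tally credits ×11 + THEOREM ×2) — continuation (RootDecomp1KDegreeLadder03): §4 engine A (onCurve_exponent_ineq, engine_core)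

(lens-1 g45 HOME kernel K = HOME/decomp-schanuel-lens-1/g45/DegreeLadder.lean EDITION 3 f2af863f…, 2183 l, imports tree `…RootDecomp1KSkelCell01` (the tree now has `…SkelCell10` with §8's `SkelLiouvilleFix`); P DLprobe.lean f44a49e4… rc 0, C DLctrl.lean 394594cd… rc 1 = exactly the 13 planted errors. Port by census-1 gen 19 as `RootDecomp1KDegreeLadder01`–`08` (+ `09` deferred): 01 = K's module doc + §0 residue (`skelLiouvilleFix_of_skelLiouville`, `SkelLiouvilleFix.liouville` / `.transcendental` declared in the TREE namespace `…RootDecomp1KSkelCell` so dot-notation keeps working) + §1 toolkit `bev`/`xdeg`/`dX`/`specX`; 02 = §2 truncations + §3 calculus (`tangent`, Lipschitz, `coeff_specX_bound`); 03 = §4 engine A (`onCurve_exponent_ineq`, `engine_core`); 04 = §4 engine B (`lowDegree_clause`, `engine_of_clause`, `engine`) + §5 THE DEGREE LADDER `degreeLadder (d) (ρ) (hρ : SkelLiouvilleFix (d + 1) ρ) (P : ℤ[X][X]) (hP : P ≠ 0) (hdeg : P.natDegree ≤ d) : bev P (liouvilleNumber 2) ρ ≠ 0` (descent `no_relation_of_engine`);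 05 = §5b limit corollary (`algebraicIndependent_of_forall_fix`) + §5c relative degree (`relDegree_gt`, `skelFix_two_not_mem_adjoin(_complex)`); 06 = §5d the residual `ThinFibre`/`ThinFibreAt` (+ glue `thinFibre_imp_b`) + §6 the toy fibre decided (`sq_fibre_iff`, `toy_clause`); 07 = §7 tightness at d = 1 (`degreeLadder_tight_one`, `rU_injective`, `not_thinFibre_one`, `not_thinFibre_zero`); 08 = §8a the 2-adic mechanism (`two_adic_split`, `two_adic_quality`, hypothesis-free); 09 (DEFERRED until Literature `…DiophantineApproximation.RidoutIntegers` builds on the check farm, rc 75 today) = §8b `isSquare_mul_psNumer_finite`, `isSquare_seventeen_mul_psNumer_finite`, `thinFibreAt_sqMulP` with `Ridout.padicRoth_int` BY NAME (K carries them under a `(hR : PadicRothInt)` binder whose `def` is NOT landed — verdict condition (c)).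
PORT EDITS: import `…SkelCell10` instead of `…SkelCell01` and DELETE K's verbatim copies of the tree's §8 (`SkelLiouvilleFix`, `skelLiouville_iff_fix`, `SkelLiouvilleFix.mono`, `uStar`, `dU`, `rU`, `dU_cast`, `two_pow_le_four_mul_dU`, `two_mul_dU_lt`, `one_le_dU`, `rU_den`, `rU_cast`, `uStar_sub_rU`, `skelLiouvilleFix_one_uStar`, `not_skelFixOne_algebraicIndependent` — 15 blocks, opened from `…RootDecomp1KSkelCell` by name; verdict condition (a)); the file-wide linter option dropped (b); 58 one-line docstrings added to undocumented helper lemmas; 34 small generic ℓ₂/`psNumer`/`partialSum`/cast lemmas made PRIVATE (dedup-safety against tree twins in TwoBaseCell/CommonRadixCell/SkelCell/RadixCell) with per-part private copies; `ThinFibre`/`ThinFibreAt` docstrings carry the residual-class tag (d); graded statements and proofs otherwise verbatim. `--supports stmt-Schanuel-33364`; no census credit carried; rung 0 — nothing here proves Schanuel, `FiniteOrderLiouvilleSchanuel` (33364), `CoordLiouvilleSchanuel` (31077) or (b) at fixed quality.)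
-/

noncomputable section

open Polynomial LiouvilleNumber
open scoped Nat

namespace Summit.Schanuel.Schanuel.Theorems.RootDecomp1KDegreeLadder

open Summit.Schanuel.Schanuel.Theorems.RootDecomp1KSkelCell
  (exists_le_two_pow_factorial iota iota_spec iota_le_of_le pow_lt_of_lt_iota lt_iota_of_pow_lt iota_mono
   one_le_iota SkelLiouville SkelLiouvilleFix skelLiouville_iff_fix SkelLiouvilleFix.mono uStar dU rU dU_cast
   two_pow_le_four_mul_dU two_mul_dU_lt one_le_dU rU_den rU_cast uStar_sub_rU skelLiouvilleFix_one_uStar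
   not_skelFixOne_algebraicIndependent)
open Summit.Schanuel.Schanuel.Theorems.RootDecomp1KTwoBaseCell (psNumer partialSum_eq_psNumer_div coprime_psNumer
  algebraicIndependent_of_forall_int')
open Summit.Schanuel.Schanuel.Theorems.RootDecomp1KRelLiouvilleCell (partialSum_two_strictMono
  partialSum_two_lt_liouvilleNumber abs_liouvilleNumber_two_sub_partialSum)

/-- `ℓ₂ := liouvilleNumber 2`. -/
private theorem ell2_eq (N : ℕ) : liouvilleNumber 2 = partialSum 2 N + remainder 2 N :=
  (partialSum_add_remainder (by norm_num) N).symm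

/-- `s_N = p_N / 2^{N!}` (tree `partialSum_eq_psNumer_div` at `b = 2`). -/
private theorem partialSum_two (N : ℕ) : partialSum 2 N = (psNumer 2 N : ℝ) / (2 : ℝ) ^ N ! := by
  have := partialSum_eq_psNumer_div (b := 2) (by norm_num) N
  simpa using this

/-- `1/2^{(N+1)!} ≤ ℓ₂ − s_N < 2/2^{(N+1)!}`. -/
private theorem remainder_two_lt (N : ℕ) : remainder 2 N < 2 / (2 : ℝ) ^ (N + 1)! := by
  have h := remainder_lt' N (m := (2 : ℝ)) (by norm_num)
  have e : (1 - 1 / (2 : ℝ))⁻¹ * (1 / 2 ^ (N + 1)!) = 2 / (2 : ℝ) ^ (N + 1)! := by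
    rw [div_eq_mul_inv (2 : ℝ) (2 ^ (N + 1)!), one_div]
    norm_num
  linarith [h, e]

/-- `1/2^{(N+1)!} ≤ ℓ₂ − s_N`. -/
private theorem le_remainder_two (N : ℕ) : 1 / (2 : ℝ) ^ (N + 1)! ≤ remainder 2 N := by
  unfold remainder
  have hs : Summable fun i : ℕ => 1 / (2 : ℝ) ^ (i + (N + 1))! := by
    simpa using remainder_summable (m := (2 : ℝ)) (by norm_num) N
  have := hs.le_tsum 0 (fun i _ => by positivity)
  simpa using this

/-- `0 < ℓ₂ − s_N`. -/
private theorem remainder_two_pos (N : ℕ) : 0 < remainder 2 N := remainder_pos (by norm_num) N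

/-! ## §4  THE ENGINE: level selection, OFF-CURVE integrality vs ON-CURVE tangent + Gauss, exchange rate `m = d + 1` -/

section Engine

/-- `0 ≤ s_N`. -/
private theorem partialSum_two_nonneg (N : ℕ) : 0 ≤ partialSum 2 N := by
  rw [partialSum_two]; positivity

/-- `ℓ₂ < 3/2`. -/
private theorem ell2_lt_three_halves : liouvilleNumber 2 < 3 / 2 := by
  rw [ell2_eq 0]
  have h1 : partialSum 2 0 = 1 / 2 := by simp [partialSum]
  have h2 := remainder_two_lt 0
  norm_num [Nat.factorial] at h2
  linarith

/-- `s_N ≤ ℓ₂`. -/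
private theorem partialSum_two_le_ell2 (N : ℕ) : partialSum 2 N ≤ liouvilleNumber 2 := by
  rw [ell2_eq N]; linarith [remainder_two_pos N]

/-- `s_N ∈ [0, 2]`. -/
private theorem partialSum_two_mem_Icc (N : ℕ) : partialSum 2 N ∈ Set.Icc (0:ℝ) 2 :=
  ⟨partialSum_two_nonneg N, by linarith [partialSum_two_le_ell2 N, ell2_lt_three_halves]⟩

/-- `ℓ₂ ∈ [0, 2]`. -/
private theorem ell2_mem_Icc : liouvilleNumber 2 ∈ Set.Icc (0:ℝ) 2 :=
  ⟨le_trans (partialSum_two_nonneg 0) (partialSum_two_le_ell2 0), by linarith [ell2_lt_three_halves]⟩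

/-- `ℓ₂ = liouvilleNumber 2` is Liouville (Mathlib). -/
private theorem liouville_ell2 : Liouville (liouvilleNumber 2) := by
  have h := liouville_liouvilleNumber (le_refl 2)
  simpa using h

/-- The closing exponent inequality of the on-curve case (`m = d + 1`): for `N ≥ L(2d+1) + d + 1`,
`L((d+1)N) + L d + (N+1)!·d ≤ N!·(d+1)N`  (i.e. `L((d+1)N + d) ≤ N!·(N − d)`). -/
theorem onCurve_exponent_ineq {L d N : ℕ} (hN : L * (2 * d + 1) + d + 1 ≤ N) :
    L * ((d + 1) * N) + L * d + (N + 1)! * d ≤ N ! * ((d + 1) * N) := by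
  obtain ⟨t, rfl⟩ : ∃ t, N = d + 1 + t := ⟨N - (d + 1), by omega⟩
  have hfac : (d + 1 + t + 1)! = (d + 1 + t + 1) * (d + 1 + t)! := Nat.factorial_succ _
  have hNN : (d + 1 + t) * (d + t) ≤ (d + 1 + t)! := by
    have h := Nat.mul_factorial_pred (by omega : d + 1 + t ≠ 0)
    rw [show d + 1 + t - 1 = d + t by omega] at h
    calc (d + 1 + t) * (d + t) ≤ (d + 1 + t) * (d + t)! :=
          Nat.mul_le_mul_left _ (Nat.self_le_factorial _)
      _ = (d + 1 + t)! := h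
  have hid : (d + 1 + t)! * ((d + 1) * (d + 1 + t)) =
      (d + 1 + t)! * (t + 1) + (d + 1 + t + 1)! * d := by
    rw [hfac]; ring
  rw [hid]
  have h1 : L * ((d + 1) * (d + 1 + t)) + L * d ≤ L * (2 * d + 1) * (d + 1 + t) := by
    have : d ≤ d * (d + 1 + t) := Nat.le_mul_of_pos_right d (by omega)
    nlinarith
  have h2 : L * (2 * d + 1) * (d + 1 + t) ≤ (d + t) * (d + 1 + t) :=
    Nat.mul_le_mul_right _ (by omega)
  have h3 : (d + t) * (d + 1 + t) ≤ (d + 1 + t)! := by rw [mul_comm]; exact hNN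
  nlinarith [h1, h2, h3, Nat.zero_le ((d + 1 + t)! * t)]

/-- **ENGINE CORE** (shared by the degree ladder and by the thin-fibre glue).  Let `P ∈ ℤ[X][Y]` have
`Y`-degree `d ≥ 1`, vanish at `(ℓ₂, ρ)` with `∂P/∂x (ℓ₂, ρ) ≠ 0`, and let `ρ ∈ Skel₍m₎`, `m ≥ 1`.  Then there is a
constant `C = C(P, ρ) > 0` such that beyond EVERY threshold `q₁` some Skel-approximant `r` (`den r ≥ q₁`) and level
`N ≥ q₁` have `r` ON THE CURVE `P(s_N, ·) = 0` (`s_N = psNumer 2 N / 2^{N!}`) with the TANGENT EXCHANGE INEQUALITY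
`den(r)^{m·N} < C · 2^{(N+1)!}`.  (The OFF-CURVE alternative `P(s_N, r) ≠ 0` is refuted inside: integrality
`|q^d P(s_N, r)| ≥ 2^{−k·N!}` against the two Lipschitz halves, each `≤ ½·2^{−k·N!}` — the level `N`,
`2^{N!} < q^{2d} ≤ 2^{(N+1)!}`, absorbs the `x`-degree `k`; nothing here depends on `m` beyond `m ≥ 1`.) -/
theorem engine_core {P : ℤ[X][X]} {ρ : ℝ} {m : ℕ} (hm : 1 ≤ m) (hd : 1 ≤ P.natDegree)
    (hroot : bev P (liouvilleNumber 2) ρ = 0) (hτ : bev (dX P) (liouvilleNumber 2) ρ ≠ 0)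
    (hρ : SkelLiouvilleFix m ρ) :
    ∃ C : ℝ, 0 < C ∧ ∀ q₁ : ℕ, ∃ (r : ℚ) (N : ℕ), q₁ ≤ r.den ∧ q₁ ≤ N ∧ |(r : ℝ) - ρ| ≤ 1 ∧
      bev P (partialSum 2 N) r = 0 ∧ specX P r ≠ 0 ∧
      (r.den : ℝ) ^ (m * N) < C * 2 ^ (N + 1)! := by
  classical
  set ℓ : ℝ := liouvilleNumber 2 with hℓ
  set d : ℕ := P.natDegree with hd'
  set k : ℕ := xdeg P with hk'
  -- constants depending on `P, ρ` only
  obtain ⟨C₂, hC₂0, hC₂⟩ := lipschitz_y P ℓ ρ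
  obtain ⟨C₆, hC₆0, hC₆⟩ := lipschitz_x P ρ
  obtain ⟨δ, hδ, htan⟩ := tangent P ℓ ρ hτ
  set τ₀ : ℝ := |bev (dX P) ℓ ρ| / 2 with hτ₀
  have hτ₀pos : 0 < τ₀ := half_pos (abs_pos.mpr hτ)
  refine ⟨C₂ / τ₀, by positivity, fun q₁ => ?_⟩
  set S : ℝ := 2 * C₂ + 16 * C₆ ^ 2 + 4 * C₆ + 2 / δ with hS
  set L : ℕ := ⌈S⌉₊ + 2 with hL
  have hSL : S ≤ (2 : ℝ) ^ L := by
    have h1 : S ≤ ⌈S⌉₊ := Nat.le_ceil S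
    have h2 : ((⌈S⌉₊ + 2 : ℕ) : ℝ) ≤ (2 : ℝ) ^ (⌈S⌉₊ + 2) := by
      exact_mod_cast (Nat.lt_two_pow_self).le
    push_cast at h2; linarith
  have hdiv2 : 0 ≤ 2 / δ := by positivity
  have hsq6 : 0 ≤ C₆ ^ 2 := sq_nonneg _
  have hB2C₂ : 2 * C₂ ≤ (2 : ℝ) ^ L := by linarith
  have hB4 : 4 * C₆ ≤ (2 : ℝ) ^ L := by linarith
  have hBδ : 2 / δ ≤ (2 : ℝ) ^ L := by linarith
  have hδL : 1 / (2 : ℝ) ^ L ≤ δ / 2 := by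
    rw [div_le_iff₀ hδ] at hBδ
    rw [div_le_div_iff₀ (by positivity) (by norm_num)]
    linarith
  have hL2 : 2 ≤ L := by rw [hL]; omega
  -- threshold, then a Skel₍m₎-approximant beyond it
  set A₂ : ℕ := 2 * d * k with hA₂
  set I₀ : ℕ := A₂ + 2 * k + 2 * d + L + q₁ + 4 with hI₀
  obtain ⟨r, hden, hne, hlt⟩ := hρ (2 ^ I₀ ! + 1)
  set q : ℕ := r.den with hq
  have hq₀ : 2 ^ I₀ ! < q := by omega
  have hq₁q : q₁ ≤ q := by
    have : I₀ ≤ 2 ^ I₀ ! := (Nat.self_le_factorial _).trans (Nat.lt_two_pow_self).le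
    omega
  set I : ℕ := iota q with hI
  have hI₀I : I₀ < I := lt_iota_of_pow_lt hq₀
  have hI1 : 1 ≤ I := by omega
  have hqlow : 2 ^ (I - 1)! < q := pow_lt_of_lt_iota (by omega)
  have hqup : q ≤ 2 ^ I ! := iota_spec q
  -- the LEVEL `N`: `2^{N!} < q^{2d} ≤ 2^{(N+1)!}`, `I − 1 ≤ N ≤ I`
  have h2d : 2 * d ≠ 0 := by omega
  set M : ℕ := iota (q ^ (2 * d)) with hM
  have hqq : q ≤ q ^ (2 * d) := Nat.le_self_pow h2d q
  have hIM : I ≤ M := iota_mono hqq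
  set N : ℕ := M - 1 with hN
  have hNM : N + 1 = M := by omega
  have hN1 : 2 ^ N ! < q ^ (2 * d) := pow_lt_of_lt_iota (by omega)
  have hN2 : q ^ (2 * d) ≤ 2 ^ (N + 1)! := by rw [hNM]; exact iota_spec _
  have hNI : N ≤ I := by
    have h : q ^ (2 * d) ≤ 2 ^ (I + 1)! := by
      calc q ^ (2 * d) ≤ (2 ^ I !) ^ (2 * d) := Nat.pow_le_pow_left hqup _
        _ = 2 ^ (I ! * (2 * d)) := (pow_mul 2 (I !) (2 * d)).symm
        _ ≤ 2 ^ (I + 1)! := Nat.pow_le_pow_right (by norm_num) (by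
            rw [Nat.factorial_succ, mul_comm (I + 1)]
            exact Nat.mul_le_mul_left _ (by omega))
    have := iota_le_of_le h
    omega
  have hNL : L ≤ N := by omega
  have hN2k : 2 * k + 1 ≤ N := by omega
  have hNq₁ : q₁ ≤ N := by omega
  have hIbig : 1 + d + 2 * d * k ≤ m * I := by
    have hI' : I ≤ m * I := Nat.le_mul_of_pos_left I (by omega)
    omega
  have hIL : L ≤ I - 1 := by omega
  -- real forms
  have hqR1 : (1 : ℝ) ≤ q := by exact_mod_cast r.den_pos
  have hqRpos : (0 : ℝ) < q := by positivity
  have hqlowR : (2 : ℝ) ^ (I - 1)! < q := by exact_mod_cast hqlow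
  have hN1R : (2 : ℝ) ^ N ! < (q : ℝ) ^ (2 * d) := by exact_mod_cast hN1
  have hLq : (2 : ℝ) ^ L ≤ q := by
    have h1 : (2 : ℝ) ^ L ≤ (2 : ℝ) ^ (I - 1)! :=
      pow_le_pow_right₀ (by norm_num) (hIL.trans (Nat.self_le_factorial _))
    linarith
  have hLW : (2 : ℝ) ^ (L + 1) ≤ (2 : ℝ) ^ (N + 1)! :=
    pow_le_pow_right₀ (by norm_num) ((by omega : L + 1 ≤ N + 1).trans (Nat.self_le_factorial _))
  -- the approximation
  have hmI : |ρ - r| < 1 / (q : ℝ) ^ (m * I) := hlt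
  have hpow1 : (q : ℝ) ≤ (q : ℝ) ^ (m * I) :=
    le_self_pow₀ hqR1 (Nat.pos_iff_ne_zero.mp (Nat.mul_pos (by omega) (by omega)))
  have hρr : |(r : ℝ) - ρ| < 1 / q := by
    rw [abs_sub_comm]; exact hmI.trans_le (one_div_le_one_div_of_le hqRpos hpow1)
  have hρr1 : |(r : ℝ) - ρ| ≤ 1 := hρr.le.trans (by rw [div_le_one hqRpos]; exact hqR1)
  have hρrδ : |(r : ℝ) - ρ| < δ := by
    have h1 : 1 / (q : ℝ) ≤ 1 / (2 : ℝ) ^ L := one_div_le_one_div_of_le (by positivity) hLq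
    linarith
  -- the truncation `s_N`
  set sN : ℝ := partialSum 2 N with hsN
  have hrem : ℓ - sN = remainder 2 N := by rw [hℓ, ell2_eq N]; ring
  have hgap_lo : 1 / (2 : ℝ) ^ (N + 1)! ≤ ℓ - sN := by rw [hrem]; exact le_remainder_two N
  have hgap_hi : ℓ - sN < 2 / (2 : ℝ) ^ (N + 1)! := by rw [hrem]; exact remainder_two_lt N
  have hgap_pos : 0 < ℓ - sN := by rw [hrem]; exact remainder_two_pos N
  have hsNlt : sN < ℓ := by linarith
  have hgapδ : ℓ - sN < δ := by
    have h1 : 2 / (2 : ℝ) ^ (N + 1)! ≤ 2 / (2 : ℝ) ^ (L + 1) :=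
      div_le_div_of_nonneg_left (by norm_num) (by positivity) hLW
    have h2 : 2 / (2 : ℝ) ^ (L + 1) = 1 / (2 : ℝ) ^ L := by
      rw [pow_succ]; field_simp
    linarith
  have hsNmem : sN ∈ Set.Icc (0 : ℝ) 2 := partialSum_two_mem_Icc N
  have hℓmem : ℓ ∈ Set.Icc (0 : ℝ) 2 := ell2_mem_Icc
  have hsNfrac : sN = (((psNumer 2 N : ℕ) : ℤ) : ℝ) / ((2 ^ N ! : ℕ) : ℝ) := by
    rw [hsN, partialSum_two]; push_cast; rfl
  have hspec : ∀ x : ℝ, aeval x (specX P r) = (q : ℝ) ^ d * bev P x r := fun x => aeval_specX P r x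
  -- `|P(ℓ₂, r)| ≤ C₂ |r − ρ| < C₂ q^{−m I}`
  have hℓr : |bev P ℓ r| < C₂ * (1 / (q : ℝ) ^ (m * I)) := by
    have h1 := hC₂ r hρr1
    rw [hroot, sub_zero] at h1
    calc |bev P ℓ r| ≤ C₂ * |(r : ℝ) - ρ| := h1
      _ < C₂ * (1 / (q : ℝ) ^ (m * I)) :=
          mul_lt_mul_of_pos_left (by rwa [abs_sub_comm] at hmI) hC₂0
  set W : ℝ := (2 : ℝ) ^ (N + 1)! with hW
  have hWpos : 0 < W := by positivity
  by_cases hA : bev P sN r = 0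
  · /- ON THE CURVE: `P(s_N, r) = 0`.  Tangent: `τ₀ (ℓ₂ − s_N) ≤ |P(ℓ₂, r)| < C₂ q^{−m N}`,
       `ℓ₂ − s_N ≥ 2^{−(N+1)!}` ⇒ `q^{m N} < (C₂/τ₀)·2^{(N+1)!}`. -/
    have htan' := htan sN r hsNlt hgapδ hρrδ
    rw [hA, sub_zero] at htan'
    have hstar : τ₀ * (q : ℝ) ^ (m * N) < C₂ * W := by
      have h1 : τ₀ * (1 / W) ≤ τ₀ * (ℓ - sN) := mul_le_mul_of_nonneg_left hgap_lo hτ₀pos.le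
      have h3 : C₂ * (1 / (q : ℝ) ^ (m * I)) ≤ C₂ * (1 / (q : ℝ) ^ (m * N)) :=
        mul_le_mul_of_nonneg_left (one_div_le_one_div_of_le (by positivity)
          (pow_le_pow_right₀ hqR1 (Nat.mul_le_mul_left _ hNI))) hC₂0.le
      have h4 : τ₀ * (1 / W) < C₂ * (1 / (q : ℝ) ^ (m * N)) := by linarith
      rw [mul_one_div, mul_one_div, div_lt_div_iff₀ hWpos (by positivity)] at h4
      linarith
    have hspec0 : specX P r ≠ 0 := by
      intro h0
      have hqd : (q : ℝ) ^ d ≠ 0 := pow_ne_zero _ hqRpos.ne'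
      have : bev P ℓ r = 0 := by
        have h1 := hspec ℓ
        rw [h0, map_zero] at h1
        rcases mul_eq_zero.mp h1.symm with h | h
        · exact absurd h hqd
        · exact h
      rw [this, abs_zero] at htan'
      have := mul_pos hτ₀pos hgap_pos
      linarith
    refine ⟨r, N, hq₁q, hNq₁, hρr1, hA, hspec0, ?_⟩
    rw [div_mul_eq_mul_div, lt_div_iff₀ hτ₀pos]
    linarith
  · /- OFF THE CURVE: `P(s_N, r) ≠ 0`.  Integrality `|q^d P(s_N, r)| ≥ 2^{−k N!}` against
       `|q^d P(s_N, r)| < q^d (C₂ q^{−m I} + 2 C₆ 2^{−(N+1)!})`, each half `≤ ½ 2^{−k N!}`. -/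
    exfalso
    have hAne : aeval ((((psNumer 2 N : ℕ) : ℤ) : ℝ) / ((2 ^ N ! : ℕ) : ℝ)) (specX P r) ≠ 0 := by
      rw [← hsNfrac, hspec]; exact mul_ne_zero (by positivity) hA
    have hlow := abs_aeval_ge_of_ne_zero (specX P r) ((psNumer 2 N : ℕ) : ℤ) (D := 2 ^ N !)
      (by positivity) (e := k) (natDegree_specX_le P r) hAne
    rw [← hsNfrac, hspec, abs_mul, abs_of_pos (by positivity : (0 : ℝ) < (q : ℝ) ^ d)] at hlow
    push_cast at hlow
    set X : ℝ := ((2 : ℝ) ^ N !) ^ k with hX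
    have hXpos : 0 < X := by positivity
    -- upper bound
    have hx := hC₆ ℓ sN r hℓmem hsNmem hρr1
    rw [abs_of_pos hgap_pos] at hx
    have hup : |bev P sN r| < C₂ * (1 / (q : ℝ) ^ (m * I)) + 2 * C₆ / W := by
      have h1 : |bev P sN r| ≤ |bev P ℓ r| + |bev P ℓ r - bev P sN r| := by
        have := abs_sub_abs_le_abs_sub (bev P sN r) (bev P ℓ r)
        rw [abs_sub_comm] at this; linarith
      have h3 : C₆ * (ℓ - sN) ≤ 2 * C₆ / W := by
        calc C₆ * (ℓ - sN) ≤ C₆ * (2 / W) := mul_le_mul_of_nonneg_left hgap_hi.le hC₆0.le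
          _ = 2 * C₆ / W := by ring
      linarith
    -- [A'] the `q`-half
    have hXq : X ≤ (q : ℝ) ^ (2 * d * k) := by
      rw [hX, pow_mul (q : ℝ) (2 * d) k]
      exact pow_le_pow_left₀ (by positivity) hN1R.le k
    have hA' : (q : ℝ) ^ d * (C₂ * (1 / (q : ℝ) ^ (m * I))) ≤ 1 / (2 * X) := by
      rw [← mul_assoc, mul_one_div, div_le_div_iff₀ (by positivity) (by positivity), one_mul]
      calc (q : ℝ) ^ d * C₂ * (2 * X) = (2 * C₂) * ((q : ℝ) ^ d * X) := by ring
        _ ≤ (q : ℝ) * ((q : ℝ) ^ d * (q : ℝ) ^ (2 * d * k)) :=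
            mul_le_mul (hB2C₂.trans hLq) (mul_le_mul_of_nonneg_left hXq (by positivity))
              (by positivity) (by positivity)
        _ = (q : ℝ) ^ (1 + d + 2 * d * k) := by rw [pow_add, pow_add, pow_one]; ring
        _ ≤ (q : ℝ) ^ (m * I) := pow_le_pow_right₀ hqR1 hIbig
    -- [B'] the `2`-half: `4 C₆ q^d 2^{k N!} ≤ 2^{(N+1)!}` via `q^d ≤ 2^{(N+1)!/2}`
    obtain ⟨H, hH⟩ : 2 ∣ (N + 1)! := Nat.dvd_factorial (by norm_num) (by omega)
    have hqH : q ^ d ≤ 2 ^ H := by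
      have h1 : (q ^ d) ^ 2 ≤ (2 ^ H) ^ 2 := by
        rw [← pow_mul, ← pow_mul, mul_comm d 2, mul_comm H 2, ← hH]; exact hN2
      exact (Nat.pow_le_pow_iff_left (by norm_num)).mp h1
    have hqHR : (q : ℝ) ^ d ≤ (2 : ℝ) ^ H := by exact_mod_cast hqH
    have hexpB : L + H + N ! * k ≤ (N + 1)! := by
      set T : ℕ := N ! * k with hT
      have h1 : (N + 1)! = (N + 1) * N ! := Nat.factorial_succ N
      have h2 : L ≤ N ! := hNL.trans (Nat.self_le_factorial N)
      have h3a : (2 * k + 2) * N ! ≤ (N + 1) * N ! := Nat.mul_le_mul_right _ (by omega)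
      have h3b : (2 * k + 2) * N ! = 2 * T + 2 * N ! := by rw [hT]; ring
      omega
    have h2X : (0 : ℝ) < 2 * X := mul_pos two_pos hXpos
    have hB' : (q : ℝ) ^ d * (2 * C₆ / W) ≤ 1 / (2 * X) := by
      rw [mul_div_assoc', div_le_div_iff₀ hWpos h2X, one_mul]
      calc (q : ℝ) ^ d * (2 * C₆) * (2 * X) = (4 * C₆) * (q : ℝ) ^ d * X := by ring
        _ ≤ (2 : ℝ) ^ L * (2 : ℝ) ^ H * X := by
            exact mul_le_mul_of_nonneg_right
              (mul_le_mul hB4 hqHR (pow_nonneg hqRpos.le d) (by positivity)) hXpos.le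
        _ = (2 : ℝ) ^ (L + H + N ! * k) := by rw [hX, ← pow_mul, ← pow_add, ← pow_add]
        _ ≤ W := pow_le_pow_right₀ (by norm_num) hexpB
    -- contradiction
    have hfin : (q : ℝ) ^ d * |bev P sN r| < 1 / (2 * X) + 1 / (2 * X) := by
      calc (q : ℝ) ^ d * |bev P sN r|
          < (q : ℝ) ^ d * (C₂ * (1 / (q : ℝ) ^ (m * I)) + 2 * C₆ / W) :=
            mul_lt_mul_of_pos_left hup (by positivity)
        _ = (q : ℝ) ^ d * (C₂ * (1 / (q : ℝ) ^ (m * I))) + (q : ℝ) ^ d * (2 * C₆ / W) := by ring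
        _ ≤ 1 / (2 * X) + 1 / (2 * X) := add_le_add hA' hB'
    have hsum : 1 / (2 * X) + 1 / (2 * X) = 1 / X := by field_simp; ring
    rw [hsum] at hfin
    linarith

end Engine

end Summit.Schanuel.Schanuel.Theorems.RootDecomp1KDegreeLadder

end
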